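import Mathlib
import Summits.ValiantsHypothesis.ValiantsHypothesis.Theorems.NewtonUnitEquationsTwoProductsFormalLogLinearisationDefs
import Summits.ValiantsHypothesis.ValiantsHypothesis.Theorems.NewtonUnitEquationsTwoProductsFormalLogLinearisationLiftedNecessity
import Summits.ValiantsHypothesis.ValiantsHypothesis.Theorems.NewtonUnitEquationsTwoProductsFormalLogLinearisationEngineOfCrux

/-!
# Crux `TwoProducts` (stmt-ValiantsHypothesis-5906), line `formal-log-linearisation`: `LiftedPencilCount` (real pencils) is necessary

Companion of `…FormalLogLinearisationLiftedNecessity.lean`, which proves `LogSumEngine ⇒ LiftedPencilCount` for positive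
INTEGER pencils.  Here the pencils are REAL, exactly as in the theory memo `memo-logSumEngine-core.md` (val-width-0318-p2,
evidence n°45 on 5906): the conclusion of `liftedPencilCount_of_logSumEngine` below is the memo's `LiftedPencilCount` body
character for character.

The reduction real ⇒ integer pencils is a ROUNDING LEMMA (`strictMin_round`): if `μ` is the strict minimiser of a positive
real grading `φ = θ₁ + c·θ₂` over a set `P ⊆ ℕ^s` of competitors, then for all large `N` and all integer vectors `t₁, t₂`
within distance `1` of `N θ₁, N θ₂`, `μ` is still the strict minimiser of `t₁ + c·t₂` over `P`: competitors of large total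
degree lose by a margin linear in their degree (the grading is bounded below by `δ·|ν|`), the finitely many small ones by
the positive gap of the original grading.  Taking `N` beyond the thresholds of the finitely many pencil-visible points and
`tₖ := ⌈N θₖ⌉₊` gives an integer pencil for which the whole set stays pencil-visible, and the integer-pencil theorem applies.

Composed with the landed converse `logSumEngine_of_twoProducts` (val-width-0318-p2, `…EngineOfCrux.lean`) this gives the
DISPROVER STATEMENT OF RECORD `liftedPencilCount_of_twoProducts : TwoProducts → LiftedPencilCount` (and its integer-pencil
form): any counterexample to the lifted pencil count refutes the crux.

Honest framing: CONDITIONAL transfers on a non-record line (the engine `LogSumEngine` and the crux are OPEN; this credits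
nothing); value = `LiftedPencilCount` in the memo's exact form becomes a tree-certified NECESSARY condition of the crux
`TwoProducts` (disprover target).  `TwoProducts` is OPEN; nothing here bears on `VP ≠ VNP`.
-/

set_option linter.dupNamespace false

noncomputable section

open scoped BigOperators
open MvPolynomial

namespace Summit.ValiantsHypothesis.ValiantsHypothesis.Theorems.NewtonUnitEquations.TwoProducts.FormalLogLinearisation

/-! ## The rounding lemma -/

/-- Perturbation estimate: if `|tₖ i − N θₖ i| ≤ 1` then the perturbed grading differs from `N` times the original one
by at most `(1 + c)·(|ν| + |μ|)` on `ν − μ`. [folklore] -/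
theorem grading_perturb_le {s : ℕ} (θ₁ θ₂ : Fin s → ℝ) (c : ℝ) (hc : 0 ≤ c) (N : ℝ) (t₁ t₂ : Fin s → ℕ)
    (ht₁ : ∀ i, |(t₁ i : ℝ) - N * θ₁ i| ≤ 1) (ht₂ : ∀ i, |(t₂ i : ℝ) - N * θ₂ i| ≤ 1) (μ ν : Fin s → ℕ) :
    N * (∑ i, (θ₁ i + c * θ₂ i) * ((ν i : ℝ) - (μ i : ℝ))) - (1 + c) * ∑ i, ((ν i : ℝ) + (μ i : ℝ)) ≤
      ∑ i, ((t₁ i : ℝ) + c * (t₂ i : ℝ)) * ((ν i : ℝ) - (μ i : ℝ)) := by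
  rw [Finset.mul_sum, Finset.mul_sum, ← Finset.sum_sub_distrib]
  refine Finset.sum_le_sum fun i _ => ?_
  have h1 := abs_le.mp (ht₁ i)
  have h2 := abs_le.mp (ht₂ i)
  have hν : (0 : ℝ) ≤ (ν i : ℝ) := Nat.cast_nonneg _
  have hμ : (0 : ℝ) ≤ (μ i : ℝ) := Nat.cast_nonneg _
  -- `ε = (t₁ + c t₂) − N(θ₁ + c θ₂)` has `|ε| ≤ 1 + c`, and `|ν − μ| ≤ ν + μ`
  have hε : |((t₁ i : ℝ) + c * (t₂ i : ℝ)) - N * (θ₁ i + c * θ₂ i)| ≤ 1 + c := by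
    rw [abs_le]
    constructor <;> nlinarith
  have hd : |(ν i : ℝ) - (μ i : ℝ)| ≤ (ν i : ℝ) + (μ i : ℝ) := by
    rw [abs_le]; constructor <;> linarith
  have key : |(((t₁ i : ℝ) + c * (t₂ i : ℝ)) - N * (θ₁ i + c * θ₂ i)) * ((ν i : ℝ) - (μ i : ℝ))| ≤
      (1 + c) * ((ν i : ℝ) + (μ i : ℝ)) := by
    rw [abs_mul]
    exact mul_le_mul hε hd (abs_nonneg _) (by linarith)
  have key' := (abs_le.mp key).1
  nlinarith

/-- **Rounding lemma.**  If `μ` strictly minimises the positive real grading `θ₁ + c·θ₂` over the competitors `P`, then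
for every large enough `N` and all integer vectors `t₁, t₂` within `1` of `N θ₁, N θ₂`, `μ` strictly minimises `t₁ + c·t₂`
over `P`. [folklore] -/
theorem strictMin_round {s : ℕ} (θ₁ θ₂ : Fin s → ℝ) (h₁ : ∀ i, 0 < θ₁ i) (h₂ : ∀ i, 0 < θ₂ i)
    (P : (Fin s → ℕ) → Prop) (μ : Fin s → ℕ) (c : ℝ) (hc : 0 < c)
    (hmin : ∀ ν, ν ≠ μ → P ν → ∑ i, (θ₁ i + c * θ₂ i) * (μ i : ℝ) < ∑ i, (θ₁ i + c * θ₂ i) * (ν i : ℝ)) :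
    ∃ N₀ : ℝ, ∀ N : ℕ, N₀ ≤ (N : ℝ) → ∀ t₁ t₂ : Fin s → ℕ, (∀ i, |(t₁ i : ℝ) - N * θ₁ i| ≤ 1) →
      (∀ i, |(t₂ i : ℝ) - N * θ₂ i| ≤ 1) →
        ∀ ν, ν ≠ μ → P ν → ∑ i, ((t₁ i : ℝ) + c * (t₂ i : ℝ)) * (μ i : ℝ) < ∑ i, ((t₁ i : ℝ) + c * (t₂ i : ℝ)) * (ν i : ℝ) := by
  classical
  -- `s = 0`: no competitors
  rcases Nat.eq_zero_or_pos s with hs | hs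
  · subst hs
    refine ⟨0, fun N _ t₁ t₂ _ _ ν hν _ => ?_⟩
    exact absurd (funext fun i => Fin.elim0 i) hν
  -- a positive lower bound `δ` for the grading coefficients
  haveI : Nonempty (Fin s) := ⟨⟨0, hs⟩⟩
  obtain ⟨i₀, -, hi₀⟩ := Finset.exists_min_image Finset.univ (fun i => θ₁ i + c * θ₂ i) Finset.univ_nonempty
  set δ : ℝ := θ₁ i₀ + c * θ₂ i₀ with hδ
  have hδpos : 0 < δ := by have := h₁ i₀; have := h₂ i₀; positivity
  have hδle : ∀ i, δ ≤ θ₁ i + c * θ₂ i := fun i => hi₀ i (Finset.mem_univ i)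
  have hEpos : 0 < 1 + c := by positivity
  set M₀ : ℝ := ∑ i, (θ₁ i + c * θ₂ i) * (μ i : ℝ) with hM₀
  have hM₀nn : 0 ≤ M₀ := Finset.sum_nonneg fun i _ => by
    have := h₁ i; have := h₂ i; positivity
  set Aμ : ℝ := ∑ i, (μ i : ℝ) with hAμ
  have hAμnn : 0 ≤ Aμ := Finset.sum_nonneg fun i _ => Nat.cast_nonneg _
  -- far threshold `R`: competitors of total degree `≥ R` lose by a margin linear in their degree
  set R : ℝ := 2 * M₀ / δ + Aμ + 1 with hR
  have hRpos : 0 < R := by positivity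
  -- the finitely many small competitors and their gap
  set T : Finset (Fin s → ℕ) := (Fintype.piFinset fun _ : Fin s => Finset.range (⌈R⌉₊ + 1)).filter
    (fun ν => ν ≠ μ ∧ P ν) with hT
  have hTmem : ∀ ν : Fin s → ℕ, ν ≠ μ → P ν → (∑ i, (ν i : ℝ)) < R → ν ∈ T := by
    intro ν hν hP hsmall
    refine Finset.mem_filter.mpr ⟨Fintype.mem_piFinset.mpr fun i => Finset.mem_range.mpr ?_, hν, hP⟩
    have hi : (ν i : ℝ) ≤ ∑ i, (ν i : ℝ) :=
      Finset.single_le_sum (f := fun i => (ν i : ℝ)) (fun i _ => Nat.cast_nonneg _) (Finset.mem_univ i)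
    have : (ν i : ℝ) < (⌈R⌉₊ : ℝ) + 1 := by linarith [Nat.le_ceil R]
    exact_mod_cast this
  obtain ⟨g, hgpos, hgap⟩ : ∃ g : ℝ, 0 < g ∧ ∀ ν ∈ T,
      g ≤ ∑ i, (θ₁ i + c * θ₂ i) * ((ν i : ℝ) - (μ i : ℝ)) := by
    by_cases hTne : T.Nonempty
    · obtain ⟨ν₀, hν₀, hmin₀⟩ := Finset.exists_min_image T
        (fun ν => ∑ i, (θ₁ i + c * θ₂ i) * ((ν i : ℝ) - (μ i : ℝ))) hTne
      obtain ⟨hne₀, hP₀⟩ := (Finset.mem_filter.mp hν₀).2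
      refine ⟨_, ?_, fun ν hν => hmin₀ ν hν⟩
      have h := hmin ν₀ hne₀ hP₀
      have : ∑ i, (θ₁ i + c * θ₂ i) * ((ν₀ i : ℝ) - (μ i : ℝ)) =
          ∑ i, (θ₁ i + c * θ₂ i) * (ν₀ i : ℝ) - ∑ i, (θ₁ i + c * θ₂ i) * (μ i : ℝ) := by
        rw [← Finset.sum_sub_distrib]; exact Finset.sum_congr rfl fun i _ => by ring
      rw [this]; linarith
    · exact ⟨1, one_pos, fun ν hν => absurd ⟨ν, hν⟩ hTne⟩
  -- the threshold
  refine ⟨max (4 * (1 + c) / δ) ((1 + c) * (R + Aμ) / g + 1), fun N hN t₁ t₂ ht₁ ht₂ ν hν hP => ?_⟩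
  have hN1 : 4 * (1 + c) / δ ≤ N := (le_max_left _ _).trans hN
  have hN2 : (1 + c) * (R + Aμ) / g + 1 ≤ N := (le_max_right _ _).trans hN
  have hN1' : 4 * (1 + c) ≤ N * δ := by rwa [div_le_iff₀ hδpos] at hN1
  have hpert := grading_perturb_le θ₁ θ₂ c hc.le N t₁ t₂ ht₁ ht₂ μ ν
  -- it suffices to show the perturbed difference is positive
  rw [← sub_pos]
  have hdiff : ∑ i, ((t₁ i : ℝ) + c * (t₂ i : ℝ)) * (ν i : ℝ) - ∑ i, ((t₁ i : ℝ) + c * (t₂ i : ℝ)) * (μ i : ℝ) =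
      ∑ i, ((t₁ i : ℝ) + c * (t₂ i : ℝ)) * ((ν i : ℝ) - (μ i : ℝ)) := by
    rw [← Finset.sum_sub_distrib]; exact Finset.sum_congr rfl fun i _ => by ring
  rw [hdiff]
  set Aν : ℝ := ∑ i, (ν i : ℝ) with hAν
  have hAνnn : 0 ≤ Aν := Finset.sum_nonneg fun i _ => Nat.cast_nonneg _
  have hsumA : ∑ i, ((ν i : ℝ) + (μ i : ℝ)) = Aν + Aμ := by rw [hAν, hAμ, ← Finset.sum_add_distrib]
  rw [hsumA] at hpert
  set D : ℝ := ∑ i, (θ₁ i + c * θ₂ i) * ((ν i : ℝ) - (μ i : ℝ)) with hD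
  -- `D ≥ δ·|ν| − M₀`
  have hDge : δ * Aν - M₀ ≤ D := by
    have h1 : δ * Aν ≤ ∑ i, (θ₁ i + c * θ₂ i) * (ν i : ℝ) := by
      rw [hAν, Finset.mul_sum]
      exact Finset.sum_le_sum fun i _ => mul_le_mul_of_nonneg_right (hδle i) (Nat.cast_nonneg _)
    have h2 : D = ∑ i, (θ₁ i + c * θ₂ i) * (ν i : ℝ) - M₀ := by
      rw [hD, hM₀, ← Finset.sum_sub_distrib]; exact Finset.sum_congr rfl fun i _ => by ring
    linarith
  by_cases hfar : R ≤ Aν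
  · -- far regime
    have hAν1 : 2 * M₀ / δ ≤ Aν := by
      have : 0 ≤ 2 * M₀ / δ := by positivity
      linarith
    have hM₀le : 2 * M₀ ≤ δ * Aν := by
      have := (div_le_iff₀ hδpos).mp hAν1
      linarith
    have hD2 : δ * Aν / 2 ≤ D := by linarith
    have hNn : (0 : ℝ) ≤ N := Nat.cast_nonneg _
    have h3 : 2 * (1 + c) * Aν ≤ N * D := by
      calc 2 * (1 + c) * Aν = (4 * (1 + c)) * Aν / 2 := by ring
        _ ≤ (N * δ) * Aν / 2 := by gcongr
        _ = N * (δ * Aν / 2) := by ring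
        _ ≤ N * D := mul_le_mul_of_nonneg_left hD2 hNn
    have h4 : Aμ < Aν := by
      have : 0 ≤ 2 * M₀ / δ := by positivity
      linarith
    have h5 : c * Aμ ≤ c * Aν := mul_le_mul_of_nonneg_left h4.le hc.le
    linarith
  · -- near regime: `ν ∈ T`, gap `g`
    push Not at hfar
    have hνT : ν ∈ T := hTmem ν hν hP hfar
    have hgD : g ≤ D := hgap ν hνT
    have hNn : (0 : ℝ) ≤ N := Nat.cast_nonneg _
    have h5 : (1 + c) * (R + Aμ) < N * g := by
      have : (1 + c) * (R + Aμ) / g < N := by linarith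
      rwa [div_lt_iff₀ hgpos] at this
    have h6 : N * g ≤ N * D := mul_le_mul_of_nonneg_left hgD hNn
    have h7 : (1 + c) * Aν ≤ (1 + c) * R := mul_le_mul_of_nonneg_left hfar.le hEpos.le
    linarith

/-! ## Real pencils -/

/-- **`LogSumEngine ⇒ LiftedPencilCount` (real pencils, the memo's signature verbatim).**  If the log-sum engine holds
(hypothesis = the line's `LogSumEngine` / STUB 5 VERBATIM; OPEN, NOT claimed), then pencil-visible multi-indices of any
pair of `m`-point configurations in `ℂ^s`, for any 2-pencil of positive REAL gradings, number at most `2^(a·m)·(s+2)^b`.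
Proof: round the pencil to a positive integer pencil keeping every point of `S` pencil-visible (`strictMin_round` with a
common `N`), then `liftedPencilCountNat_of_logSumEngine`. [folklore] -/
theorem liftedPencilCount_of_logSumEngine
    (hE : ∃ a b : ℕ, ∀ (m t : ℕ), 2 ≤ t → ∀ (u v : Fin m → MvPolynomial (Fin 2) ℂ),
      (∀ j, coeff 0 (u j) = 0 ∧ (u j).support.card ≤ t) → (∀ j, coeff 0 (v j) = 0 ∧ (v j).support.card ≤ t) →
        ∀ S : Finset Expo, (↑S ⊆ logVisible u v) → S.card ≤ 2 ^ (a * m) * (t + 2) ^ b) :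
    ∃ a b : ℕ, ∀ (m s : ℕ) (A B : Fin m → Fin s → ℂ) (θ₁ θ₂ : Fin s → ℝ),
      (∀ i, 0 < θ₁ i) → (∀ i, 0 < θ₂ i) →
      ∀ S : Finset (Fin s → ℕ),
        (∀ μ ∈ S, (∑ j, ∏ i, A j i ^ μ i) ≠ (∑ j, ∏ i, B j i ^ μ i) ∧
          ∃ c : ℝ, 0 < c ∧ ∀ ν : Fin s → ℕ, ν ≠ μ →
            (∑ j, ∏ i, A j i ^ ν i) ≠ (∑ j, ∏ i, B j i ^ ν i) →
              ∑ i, (θ₁ i + c * θ₂ i) * (μ i : ℝ) < ∑ i, (θ₁ i + c * θ₂ i) * (ν i : ℝ)) →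
        S.card ≤ 2 ^ (a * m) * (s + 2) ^ b := by
  classical
  obtain ⟨a, b, hN⟩ := liftedPencilCountNat_of_logSumEngine hE
  refine ⟨a, b, fun m s A B θ₁ θ₂ hθ₁ hθ₂ S hS => ?_⟩
  -- per-point thresholds
  have hround : ∀ μ ∈ S, ∃ c : ℝ, 0 < c ∧ ∃ N₀ : ℝ, ∀ N : ℕ, N₀ ≤ (N : ℝ) → ∀ t₁ t₂ : Fin s → ℕ,
      (∀ i, |(t₁ i : ℝ) - N * θ₁ i| ≤ 1) → (∀ i, |(t₂ i : ℝ) - N * θ₂ i| ≤ 1) →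
        ∀ ν, ν ≠ μ → (∑ j, ∏ i, A j i ^ ν i) ≠ (∑ j, ∏ i, B j i ^ ν i) →
          ∑ i, ((t₁ i : ℝ) + c * (t₂ i : ℝ)) * (μ i : ℝ) < ∑ i, ((t₁ i : ℝ) + c * (t₂ i : ℝ)) * (ν i : ℝ) := by
    intro μ hμ
    obtain ⟨-, c, hc, hmin⟩ := hS μ hμ
    exact ⟨c, hc, strictMin_round θ₁ θ₂ hθ₁ hθ₂ _ μ c hc hmin⟩
  choose! cS hcS N₀ hN₀ using hround
  rcases S.eq_empty_or_nonempty with hSe | hSne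
  · rw [hSe, Finset.card_empty]; exact Nat.zero_le _
  -- a common `N ≥ 1` above all thresholds
  obtain ⟨N, hNge⟩ := exists_nat_ge (max 1 (S.sup' hSne N₀))
  have hN1 : (1 : ℝ) ≤ N := (le_max_left _ _).trans hNge
  have hNμ : ∀ μ ∈ S, N₀ μ ≤ (N : ℝ) := fun μ hμ =>
    ((Finset.le_sup' N₀ hμ).trans (le_max_right _ _)).trans hNge
  -- the rounded pencil
  set t₁ : Fin s → ℕ := fun i => ⌈(N : ℝ) * θ₁ i⌉₊ with ht₁
  set t₂ : Fin s → ℕ := fun i => ⌈(N : ℝ) * θ₂ i⌉₊ with ht₂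
  have hround₁ : ∀ i, |(t₁ i : ℝ) - N * θ₁ i| ≤ 1 := by
    intro i
    have hx : 0 ≤ (N : ℝ) * θ₁ i := by have := hθ₁ i; positivity
    have h1 : (N : ℝ) * θ₁ i ≤ (t₁ i : ℝ) := Nat.le_ceil _
    have h2 : (t₁ i : ℝ) < (N : ℝ) * θ₁ i + 1 := Nat.ceil_lt_add_one hx
    rw [abs_le]; constructor <;> linarith
  have hround₂ : ∀ i, |(t₂ i : ℝ) - N * θ₂ i| ≤ 1 := by
    intro i
    have hx : 0 ≤ (N : ℝ) * θ₂ i := by have := hθ₂ i; positivity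
    have h1 : (N : ℝ) * θ₂ i ≤ (t₂ i : ℝ) := Nat.le_ceil _
    have h2 : (t₂ i : ℝ) < (N : ℝ) * θ₂ i + 1 := Nat.ceil_lt_add_one hx
    rw [abs_le]; constructor <;> linarith
  have hpos₁ : ∀ i, 0 < t₁ i := fun i => Nat.ceil_pos.mpr (by have := hθ₁ i; positivity)
  have hpos₂ : ∀ i, 0 < t₂ i := fun i => Nat.ceil_pos.mpr (by have := hθ₂ i; positivity)
  refine hN m s A B t₁ t₂ hpos₁ hpos₂ S fun μ hμ => ⟨(hS μ hμ).1, cS μ, hcS μ hμ, ?_⟩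
  intro ν hν hG
  have h := hN₀ μ hμ N (hNμ μ hμ) t₁ t₂ hround₁ hround₂ ν hν hG
  simpa using h


/-! ## The disprover statement of record: `TwoProducts ⇒ LiftedPencilCount` -/

/-- **`TwoProducts ⇒ LiftedPencilCount` (real pencils).**  The crux implies the lifted pencil count (memo signature
verbatim): composition of the landed converse `logSumEngine_of_twoProducts` with `liftedPencilCount_of_logSumEngine`.
Contrapositive = the disprover target: a configuration pair with too many pencil-visible multi-indices refutes the crux.
[folklore] -/
theorem liftedPencilCount_of_twoProducts (h : Summit.ValiantsHypothesis.ValiantsHypothesis.Theses.NewtonUnitEquations.TwoProducts) :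
    ∃ a b : ℕ, ∀ (m s : ℕ) (A B : Fin m → Fin s → ℂ) (θ₁ θ₂ : Fin s → ℝ),
      (∀ i, 0 < θ₁ i) → (∀ i, 0 < θ₂ i) →
      ∀ S : Finset (Fin s → ℕ),
        (∀ μ ∈ S, (∑ j, ∏ i, A j i ^ μ i) ≠ (∑ j, ∏ i, B j i ^ μ i) ∧
          ∃ c : ℝ, 0 < c ∧ ∀ ν : Fin s → ℕ, ν ≠ μ →
            (∑ j, ∏ i, A j i ^ ν i) ≠ (∑ j, ∏ i, B j i ^ ν i) →
              ∑ i, (θ₁ i + c * θ₂ i) * (μ i : ℝ) < ∑ i, (θ₁ i + c * θ₂ i) * (ν i : ℝ)) →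
        S.card ≤ 2 ^ (a * m) * (s + 2) ^ b :=
  liftedPencilCount_of_logSumEngine (logSumEngine_of_twoProducts h)

/-- **`TwoProducts ⇒ LiftedPencilCount` (integer pencils)** — the form a kit search instantiates. [folklore] -/
theorem liftedPencilCountNat_of_twoProducts
    (h : Summit.ValiantsHypothesis.ValiantsHypothesis.Theses.NewtonUnitEquations.TwoProducts) :
    ∃ a b : ℕ, ∀ (m s : ℕ) (A B : Fin m → Fin s → ℂ) (θ₁ θ₂ : Fin s → ℕ),
      (∀ i, 0 < θ₁ i) → (∀ i, 0 < θ₂ i) →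
      ∀ S : Finset (Fin s → ℕ),
        (∀ μ ∈ S, (∑ j, ∏ i, A j i ^ μ i) ≠ (∑ j, ∏ i, B j i ^ μ i) ∧
          ∃ c : ℝ, 0 < c ∧ ∀ ν : Fin s → ℕ, ν ≠ μ →
            (∑ j, ∏ i, A j i ^ ν i) ≠ (∑ j, ∏ i, B j i ^ ν i) →
              ∑ i, (((θ₁ i : ℕ) : ℝ) + c * ((θ₂ i : ℕ) : ℝ)) * ((μ i : ℕ) : ℝ) <
                ∑ i, (((θ₁ i : ℕ) : ℝ) + c * ((θ₂ i : ℕ) : ℝ)) * ((ν i : ℕ) : ℝ)) →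
        S.card ≤ 2 ^ (a * m) * (s + 2) ^ b :=
  liftedPencilCountNat_of_logSumEngine (logSumEngine_of_twoProducts h)

end Summit.ValiantsHypothesis.ValiantsHypothesis.Theorems.NewtonUnitEquations.TwoProducts.FormalLogLinearisation

end
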